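import Literature.NumberTheory.Rogawski1990.TestFunctionsPair
import Literature.NumberTheory.Rogawski1990.AdelicStableConjugacyG
import Literature.NumberTheory.Rogawski1990.LocalTransferFundamentalLemma
import HarnessLib

/-!
# The value of a pure tensor on `U(H₂)(𝔸) × U(H₁)(𝔸)` at a point: archimedean factor × a FINITE product of local factors
# (Rogawski (1990), §4.9 p. 54; Borel–Jacquet, Corvallis (1979), §4.1)

Topic `NumberTheory/Rogawski1990`; namespace `Literature.NumberTheory.Automorphic.UnitaryGroup.PureTensor₂` (as ★ `TestFunctionsPair`).  THEOREMS ONLY over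
accepted tree modules (no definition, no named fact, no instance, no notation, no `sorry`).  Cell `pub/hodgecm-mathlib`, floor 0, programme F0∕P3a, the
«#88 side» (pay-down of ★ `Rogawski1990.SingularEllipticTransferCanonical`, LEAD DESK WORDS T6-18∕T6-20; FILE A of F0P3a-p07 (g4)'s (κ-MASS) glue, split
offer 2026-08-31T17:33Z): the evaluation of a factorizable `f^H = f^H_∞ ⊗ ⊗_v f^H_v` (★ `PureTensor₂`, `eval`) at an adelic pair, in particular at the
diagonal image of a RATIONAL pair `γ_H = (γ₂, γ₁) ∈ U(H₂)(L⁺) × U(H₁)(L⁺)`, as the archimedean factor at `γ_H ⊗ 1` times the product of the local factors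
over ANY finite set of places `S ⊇ T.S` outside which the local components lie in the levels — «`f(γ) = f_∞(γ_∞) ∏_{v ∈ S} f_v(γ_v)`, the factors off `S`
being `1`» ([BorelJacquet1979, §4.1]; [Rogawski1990, §4.9 p. 54]).

* §1 `arch_mul_prod_loc_eq_eval` — for ANY pair `p` and finite `S ⊇ T.S` with `p_v ∈ K₂ v × K₁ v` for `v ∉ S`:
  `T.arch p_∞ · ∏_{v ∈ S} T.loc v p_v = T.eval p` (both sides vanish when some `p_v ∉ K₂ v × K₁ v`, `v ∉ T.S`: `eval` by ★ `eval_eq_zero_of_not_mem`,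
  the product through the indicator factor ★ `loc_eq_indicator`); `eval_eq_arch_mul_prod_loc` (the same, read right to left).
* §2 for an UNRAMIFIED tensor (★ `IsUnramified₂`: levels = ★ `cmLocalIntegralLevel` off `T.S`) such an `S` EXISTS for every pair:
  `finite_setOf_not_mem_level` (★ `eventually_toLocal_mem_cmLocalIntegralLevel` — adelic points are integral a.e.), `exists_finset_forall_mem_level`;
  and the local factors off `T.S` are genuine test functions: `isLocSmooth_loc_of_not_mem` (★ `isLocSmooth_indicator` on the compact open
  `U(H₂)(𝒪_v) × U(H₁)(𝒪_v)`, ★ `isCompact_isOpen_cmLocalIntegralLevel`).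
* §3 the RATIONAL dress `arch_mul_prod_loc_eq_eval_toAdelic` — at `p = (γ₂ ⊗ 1, γ₁ ⊗ 1)` (★ `cmDatum.toAdelic`) the archimedean component is
  `(cmRationalToArch γ₂, cmRationalToArch γ₁)` (★ `archPart_cmDatum_toAdelic`), so
  `T.arch (γ_H ⊗ 1)_∞ · ∏_{v ∈ S} T.loc v (γ_H)_v = T.eval (γ_H ⊗ 1)` — the shape FILE B (`SingularKappaMassGlue`, p07) consumes.

HONEST LABEL.  HC_CM is proved only modulo the printed citations (named inputs remaining 2) until rung 0 closes; this file is unconditional bookkeeping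
about pure tensors and asserts nothing about transfer.

## References
* [Rogawski1990] J. D. Rogawski, *Automorphic Representations of Unitary Groups in Three Variables*, Ann. of Math. Stud. 123 (1990), §4.9 p. 54
  (factorizable `f`, `f^H`), §14.2 p. 233.
* [BorelJacquet1979] A. Borel, H. Jacquet, *Automorphic forms and automorphic representations*, Proc. Sympos. Pure Math. 33.1 (1979), §4.1
  (restricted tensor products; `f = ⊗ f_v` with `f_v = 1_{K_v}` for almost all `v`).
-/

set_option autoImplicit false

noncomputable section

open NumberField IsDedekindDomain Filter Set
open Literature.NumberTheory.Rogawski1990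
open scoped Classical

namespace Literature.NumberTheory.Automorphic.UnitaryGroup

namespace PureTensor₂

variable (L : Type) [Field L] [NumberField L] [IsCMField L] {N₂ N₁ : ℕ}
  {H₂ : Matrix (Fin N₂) (Fin N₂) L} {H₁ : Matrix (Fin N₁) (Fin N₁) L}

/-! ## §1 Evaluation as archimedean factor × a finite product over any admissible `S` -/

/-- **`f(p) = f_∞(p_∞) · ∏_{v ∈ S} f_v(p_v)` for every finite `S ⊇ T.S` off which the local components lie in the levels.**  If moreover `p` is
unramified off `T.S` both sides are ★ `eval_eq_of_mem`'s value (the extra factors `v ∈ S ∖ T.S` are `1_{K₂ v × K₁ v}(p_v) = 1`, ★ `loc_eq_indicator`);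
otherwise some `v ∉ T.S` has `p_v ∉ K₂ v × K₁ v`, that `v` lies in `S`, its factor is `0`, and `eval p = 0` (★ `eval_eq_zero_of_not_mem`).
[cite: BorelJacquet1979, §4.1] [cite: Rogawski1990, §4.9 p. 54] -/
theorem arch_mul_prod_loc_eq_eval (T : PureTensor₂ L H₂ H₁) (p : (cmDatum L N₂ H₂).Adelic × (cmDatum L N₁ H₁).Adelic)
    {S : Finset (HeightOneSpectrum (𝓞 ↥(maximalRealSubfield L)))} (hS : T.S ⊆ S)
    (hp : ∀ v ∉ S, (cmDatum L N₂ H₂).toLocal v p.1 ∈ T.K₂ v ∧ (cmDatum L N₁ H₁).toLocal v p.2 ∈ T.K₁ v) :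
    T.arch (archPair p) * ∏ v ∈ S, T.loc v (locPair v p) = T.eval p := by
  by_cases hmem : p ∈ T.unramifiedSet
  · rw [eval_eq_of_mem T hmem]
    congr 1
    refine (Finset.prod_subset hS fun v hvS hvT => ?_).symm
    rw [T.loc_eq_indicator v hvT, Set.indicator_of_mem (Set.mk_mem_prod (hmem v hvT).1 (hmem v hvT).2)]
  · rw [eval_eq_zero_of_not_mem T hmem]
    simp only [mem_unramifiedSet_iff, not_forall] at hmem
    obtain ⟨v, hvT, hv⟩ := hmem
    have hvS : v ∈ S := by
      by_contra h
      exact hv (hp v h)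
    rw [Finset.prod_eq_zero hvS, mul_zero]
    rw [T.loc_eq_indicator v hvT, Set.indicator_of_notMem]
    exact fun h => hv ⟨h.1, h.2⟩

/-- The same identity read as a formula for `eval`. [cite: BorelJacquet1979, §4.1] -/
theorem eval_eq_arch_mul_prod_loc (T : PureTensor₂ L H₂ H₁) (p : (cmDatum L N₂ H₂).Adelic × (cmDatum L N₁ H₁).Adelic)
    {S : Finset (HeightOneSpectrum (𝓞 ↥(maximalRealSubfield L)))} (hS : T.S ⊆ S)
    (hp : ∀ v ∉ S, (cmDatum L N₂ H₂).toLocal v p.1 ∈ T.K₂ v ∧ (cmDatum L N₁ H₁).toLocal v p.2 ∈ T.K₁ v) :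
    T.eval p = T.arch (archPair p) * ∏ v ∈ S, T.loc v (locPair v p) :=
  (arch_mul_prod_loc_eq_eval L T p hS hp).symm

/-! ## §2 Unramified tensors: a finite admissible `S` exists for every pair; the factors off `T.S` are test functions -/

/-- **Adelic pairs are in the levels of an unramified tensor for almost every `v`**: the set of finite places `v` with `p_v ∉ K₂ v × K₁ v` is finite
(★ `eventually_toLocal_mem_cmLocalIntegralLevel` on both components, and `K₂ v × K₁ v = U(H₂)(𝒪_v) × U(H₁)(𝒪_v)` off the finite `T.S`).
[cite: BorelJacquet1979, §4.1] -/
theorem finite_setOf_not_mem_level (T : PureTensor₂ L H₂ H₁) (hT : T.IsUnramified₂)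
    (p : (cmDatum L N₂ H₂).Adelic × (cmDatum L N₁ H₁).Adelic) :
    Set.Finite {v : HeightOneSpectrum (𝓞 ↥(maximalRealSubfield L)) |
      ¬ ((cmDatum L N₂ H₂).toLocal v p.1 ∈ T.K₂ v ∧ (cmDatum L N₁ H₁).toLocal v p.2 ∈ T.K₁ v)} := by
  have h₂ := eventually_toLocal_mem_cmLocalIntegralLevel p.1
  have h₁ := eventually_toLocal_mem_cmLocalIntegralLevel p.2
  have hS : ∀ᶠ v in cofinite, v ∉ T.S := T.S.finite_toSet.compl_mem_cofinite
  have h : ∀ᶠ v in cofinite, (cmDatum L N₂ H₂).toLocal v p.1 ∈ T.K₂ v ∧ (cmDatum L N₁ H₁).toLocal v p.2 ∈ T.K₁ v := by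
    filter_upwards [h₂, h₁, hS] with v hv₂ hv₁ hv
    exact ⟨(hT v hv).1 ▸ hv₂, (hT v hv).2 ▸ hv₁⟩
  exact Filter.eventually_cofinite.mp h

/-- **A finite admissible `S ⊇ T.S` exists for every pair** (unramified tensor). [cite: BorelJacquet1979, §4.1] -/
theorem exists_finset_forall_mem_level (T : PureTensor₂ L H₂ H₁) (hT : T.IsUnramified₂)
    (p : (cmDatum L N₂ H₂).Adelic × (cmDatum L N₁ H₁).Adelic) :
    ∃ S : Finset (HeightOneSpectrum (𝓞 ↥(maximalRealSubfield L))), T.S ⊆ S ∧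
      ∀ v ∉ S, (cmDatum L N₂ H₂).toLocal v p.1 ∈ T.K₂ v ∧ (cmDatum L N₁ H₁).toLocal v p.2 ∈ T.K₁ v := by
  refine ⟨T.S ∪ (finite_setOf_not_mem_level L T hT p).toFinset, Finset.subset_union_left, fun v hv => ?_⟩
  by_contra h
  exact hv (Finset.mem_union_right _ ((Set.Finite.mem_toFinset _).mpr h))

/-- **Off `T.S` the local factor of an unramified tensor is a test function**: `1_{U(H₂)(𝒪_v) × U(H₁)(𝒪_v)} ∈ C_c^∞` (locally constant, compactly
supported: ★ `isLocSmooth_indicator` on the compact open product of the integral levels, ★ `isCompact_isOpen_cmLocalIntegralLevel`).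
[cite: Rogawski1990, §4.9 Prop. 4.9.1 (b) p. 55] [cite: BorelJacquet1979, §4.1] -/
theorem isLocSmooth_loc_of_not_mem (T : PureTensor₂ L H₂ H₁) (hT : T.IsUnramified₂)
    {v : HeightOneSpectrum (𝓞 ↥(maximalRealSubfield L))} (hv : v ∉ T.S) : Literature.NumberTheory.Rogawski1990.IsLocSmooth (T.loc v) := by
  rw [T.loc_eq_indicator v hv, (hT v hv).1, (hT v hv).2]
  have h₂ := isCompact_isOpen_cmLocalIntegralLevel L N₂ H₂ v
  have h₁ := isCompact_isOpen_cmLocalIntegralLevel L N₁ H₁ v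
  -- the product of the two integral levels is an open compact SUBGROUP of the product local group (open subgroups are closed)
  have hK : (((cmLocalIntegralLevel L N₂ H₂ v).prod (cmLocalIntegralLevel L N₁ H₁ v) :
      Subgroup ((cmDatum L N₂ H₂).Local v × (cmDatum L N₁ H₁).Local v)) : Set ((cmDatum L N₂ H₂).Local v × (cmDatum L N₁ H₁).Local v)) =
      (cmLocalIntegralLevel L N₂ H₂ v : Set ((cmDatum L N₂ H₂).Local v)) ×ˢ (cmLocalIntegralLevel L N₁ H₁ v : Set ((cmDatum L N₁ H₁).Local v)) :=
    Subgroup.coe_prod _ _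
  rw [← hK]
  exact Literature.NumberTheory.Rogawski1990.isLocSmooth_indicator_subgroup _ (by rw [hK]; exact h₂.2.prod h₁.2)
    (by rw [hK]; exact h₂.1.prod h₁.1)

/-! ## §3 The rational dress: evaluation at `γ_H ⊗ 1` -/

/-- **`f^H(γ_H ⊗ 1) = f^H_∞(γ_H ⊗ 1) · ∏_{v ∈ S} f^H_v((γ_H)_v)`** for a RATIONAL pair `γ_H = (γ₂, γ₁) ∈ U(H₂)(L⁺) × U(H₁)(L⁺)` and every finite
`S ⊇ T.S` off which `(γ_H)_v ∈ K₂ v × K₁ v` (such `S` exist for unramified tensors: `exists_finset_forall_mem_level`); the archimedean component of the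
diagonal image is `(γ₂ ⊗ 1, γ₁ ⊗ 1) = (cmRationalToArch γ₂, cmRationalToArch γ₁)` (★ `archPart_cmDatum_toAdelic`). [cite: Rogawski1990, §4.9 p. 54; §14.5 p. 239]
[cite: BorelJacquet1979, §4.1] -/
theorem arch_mul_prod_loc_eq_eval_toAdelic (T : PureTensor₂ L H₂ H₁) (γ : (cmDatum L N₂ H₂).Rational × (cmDatum L N₁ H₁).Rational)
    {S : Finset (HeightOneSpectrum (𝓞 ↥(maximalRealSubfield L)))} (hS : T.S ⊆ S)
    (hp : ∀ v ∉ S, (cmDatum L N₂ H₂).toLocal v ((cmDatum L N₂ H₂).toAdelic γ.1) ∈ T.K₂ v ∧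
      (cmDatum L N₁ H₁).toLocal v ((cmDatum L N₁ H₁).toAdelic γ.2) ∈ T.K₁ v) :
    T.arch (cmRationalToArch L N₂ H₂ γ.1, cmRationalToArch L N₁ H₁ γ.2) *
        ∏ v ∈ S, T.loc v ((cmDatum L N₂ H₂).toLocal v ((cmDatum L N₂ H₂).toAdelic γ.1),
          (cmDatum L N₁ H₁).toLocal v ((cmDatum L N₁ H₁).toAdelic γ.2)) =
      T.eval ((cmDatum L N₂ H₂).toAdelic γ.1, (cmDatum L N₁ H₁).toAdelic γ.2) := by
  rw [← archPart_cmDatum_toAdelic L N₂ H₂ γ.1, ← archPart_cmDatum_toAdelic L N₁ H₁ γ.2]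
  exact arch_mul_prod_loc_eq_eval L T ((cmDatum L N₂ H₂).toAdelic γ.1, (cmDatum L N₁ H₁).toAdelic γ.2) hS hp

/-- The rational dress read as a formula for `eval (γ_H ⊗ 1)`. [cite: Rogawski1990, §4.9 p. 54] [cite: BorelJacquet1979, §4.1] -/
theorem eval_toAdelic_eq_arch_mul_prod_loc (T : PureTensor₂ L H₂ H₁) (γ : (cmDatum L N₂ H₂).Rational × (cmDatum L N₁ H₁).Rational)
    {S : Finset (HeightOneSpectrum (𝓞 ↥(maximalRealSubfield L)))} (hS : T.S ⊆ S)
    (hp : ∀ v ∉ S, (cmDatum L N₂ H₂).toLocal v ((cmDatum L N₂ H₂).toAdelic γ.1) ∈ T.K₂ v ∧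
      (cmDatum L N₁ H₁).toLocal v ((cmDatum L N₁ H₁).toAdelic γ.2) ∈ T.K₁ v) :
    T.eval ((cmDatum L N₂ H₂).toAdelic γ.1, (cmDatum L N₁ H₁).toAdelic γ.2) =
      T.arch (cmRationalToArch L N₂ H₂ γ.1, cmRationalToArch L N₁ H₁ γ.2) *
        ∏ v ∈ S, T.loc v ((cmDatum L N₂ H₂).toLocal v ((cmDatum L N₂ H₂).toAdelic γ.1),
          (cmDatum L N₁ H₁).toLocal v ((cmDatum L N₁ H₁).toAdelic γ.2)) :=
  (arch_mul_prod_loc_eq_eval_toAdelic L T γ hS hp).symm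

/-- **Unramified tensors: the rational dress with its own `S`** — there is a finite `S ⊇ T.S` with `(γ_H)_v ∈ K₂ v × K₁ v` off `S`, and for it
`f^H(γ_H ⊗ 1) = f^H_∞(γ_H ⊗ 1) · ∏_{v ∈ S} f^H_v((γ_H)_v)`. [cite: Rogawski1990, §4.9 p. 54] [cite: BorelJacquet1979, §4.1] -/
theorem exists_finset_eval_toAdelic_eq (T : PureTensor₂ L H₂ H₁) (hT : T.IsUnramified₂)
    (γ : (cmDatum L N₂ H₂).Rational × (cmDatum L N₁ H₁).Rational) :
    ∃ S : Finset (HeightOneSpectrum (𝓞 ↥(maximalRealSubfield L))), T.S ⊆ S ∧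
      (∀ v ∉ S, (cmDatum L N₂ H₂).toLocal v ((cmDatum L N₂ H₂).toAdelic γ.1) ∈ T.K₂ v ∧
        (cmDatum L N₁ H₁).toLocal v ((cmDatum L N₁ H₁).toAdelic γ.2) ∈ T.K₁ v) ∧
      T.eval ((cmDatum L N₂ H₂).toAdelic γ.1, (cmDatum L N₁ H₁).toAdelic γ.2) =
        T.arch (cmRationalToArch L N₂ H₂ γ.1, cmRationalToArch L N₁ H₁ γ.2) *
          ∏ v ∈ S, T.loc v ((cmDatum L N₂ H₂).toLocal v ((cmDatum L N₂ H₂).toAdelic γ.1),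
            (cmDatum L N₁ H₁).toLocal v ((cmDatum L N₁ H₁).toAdelic γ.2)) := by
  obtain ⟨S, hS, hp⟩ := exists_finset_forall_mem_level L T hT ((cmDatum L N₂ H₂).toAdelic γ.1, (cmDatum L N₁ H₁).toAdelic γ.2)
  exact ⟨S, hS, hp, eval_toAdelic_eq_arch_mul_prod_loc L T γ hS hp⟩

end PureTensor₂

end Literature.NumberTheory.Automorphic.UnitaryGroup

end
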